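import Literature.NumberTheory.Automorphic.ArchCoordinatesGL
import Literature.NumberTheory.Automorphic.ArchimedeanExpChart
import Mathlib.MeasureTheory.Function.Jacobian
import Mathlib.MeasureTheory.Measure.Haar.Unique
import Mathlib.Analysis.Calculus.Deriv.Abs
import HarnessLib

/-!
# Exponential coordinates on `GL_n(K_∞)` against linear coordinates: change of variables for
# compactly supported weights

Topic `NumberTheory/Automorphic`; a brick of the discharge of Harish-Chandra's convolution
identity `AutomorphicRepsGL.exists_convolution_eq_self` (`HarishChandraConvolutionGL`), joining the
exponential coordinates of `ArchimedeanExpChart` (in which the reproducing identity of automorphic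
forms is proved, `AutomorphicFormsReproducingKernel`) to the linear coordinates of
`ArchCoordinatesGL` (in which the Haar measure of `GL_n(K_∞)` is computed,
`HaarGLnArchCoordinates`). For a continuous linear isomorphism `Λ : ℝ^d ≃ M_n(K_∞)` we prove:

* `exists_integral_comp_continuousLinearEquiv` — additive Haar measures on two finite-dimensional
  spaces are matched by a linear isomorphism up to a positive constant;
* `contDiff_exp_matrix` — the matrix exponential is smooth (it is analytic);
* `exists_coordWeight_of_expChart` — **there is `ρ₀ > 0` such that every smooth `α₀` supported in
  the ball `B(0, ρ₀) ⊆ ℝ^d` has a smooth compactly supported companion `β` on the coordinate space,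
  supported in `glUnitSet`, with `∫ α₀(t) Ψ(glCoord (exp (Λ t))) dt = ∫ β(s) Ψ(s) ds` for EVERY
  `Ψ`**: the change of variables along the local inverse `u ↦ Λ⁻¹ log (Λ u)` of
  `t ↦ Λ⁻¹ exp (Λ t)` (Mathlib's `integral_image_eq_integral_abs_det_fderiv_smul`, the local
  logarithm `exists_log_contDiffAt_nhds_one` of `ArchimedeanExpChart`), whose Jacobian is smooth
  (`contDiff_clm_det`), followed by the linear change of variables `Λ`, `glCoord`.

Everything is proved; no definitions, no named facts.

## References

* A. W. Knapp, *Lie Groups Beyond an Introduction*, 2nd ed. (2002), I.§10 (exponential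
  coordinates), VIII.§2 (Haar measure in coordinates) [Knapp2002].
* N. Bourbaki, *Intégration*, Ch. VII §1 [folklore].
-/

noncomputable section

open scoped MatrixGroups Matrix Topology ContDiff Classical
open Filter MeasureTheory NumberField NumberField.mixedEmbedding IsDedekindDomain Set Metric

namespace Literature.NumberTheory.Automorphic

/-! ### 0. Generic lemmas -/

section Generic

/-- **Linear isomorphisms match Haar measures up to a positive constant**: for additive Haar
measures `μ₁`, `μ₂` on finite-dimensional real spaces and `T : E₁ ≃L E₂` there is `c > 0` with
`∫ g (T x) dμ₁ = c ∫ g dμ₂` for all `g`. [folklore] -/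
theorem exists_integral_comp_continuousLinearEquiv {E₁ E₂ : Type*}
    [NormedAddCommGroup E₁] [NormedSpace ℝ E₁] [FiniteDimensional ℝ E₁] [MeasurableSpace E₁]
    [BorelSpace E₁] [NormedAddCommGroup E₂] [NormedSpace ℝ E₂] [FiniteDimensional ℝ E₂]
    [MeasurableSpace E₂] [BorelSpace E₂] (μ₁ : Measure E₁) [μ₁.IsAddHaarMeasure]
    (μ₂ : Measure E₂) [μ₂.IsAddHaarMeasure] (T : E₁ ≃L[ℝ] E₂) :
    ∃ c : ℝ, 0 < c ∧ ∀ g : E₂ → ℂ, ∫ x, g (T x) ∂μ₁ = (c : ℂ) * ∫ y, g y ∂μ₂ := by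
  set ν : Measure E₂ := μ₁.map T with hν
  haveI : ν.IsAddHaarMeasure := T.isAddHaarMeasure_map μ₁
  have hνeq : ν = Measure.addHaarScalarFactor ν μ₂ • μ₂ := Measure.isAddLeftInvariant_eq_smul ν μ₂
  have hpos : 0 < Measure.addHaarScalarFactor ν μ₂ :=
    Measure.addHaarScalarFactor_pos_of_isAddHaarMeasure ν μ₂
  refine ⟨Measure.addHaarScalarFactor ν μ₂, NNReal.coe_pos.2 hpos, fun g => ?_⟩
  have h1 : ∫ x, g (T x) ∂μ₁ = ∫ y, g y ∂ν := by
    rw [hν]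
    have := integral_map_equiv (μ := μ₁) T.toHomeomorph.toMeasurableEquiv g
    rw [Homeomorph.toMeasurableEquiv_coe] at this
    exact this.symm
  rw [h1]
  conv_lhs => rw [hνeq]
  rw [integral_smul_nnreal_measure, NNReal.smul_def, Complex.real_smul]

/-- **The determinant is a smooth function on the continuous endomorphisms** of a
finite-dimensional real space (a polynomial in the matrix entries). [folklore] -/
theorem contDiff_clm_det {V : Type*} [NormedAddCommGroup V] [NormedSpace ℝ V] [FiniteDimensional ℝ V] :
    ContDiff ℝ ∞ fun f : V →L[ℝ] V => f.det := by
  classical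
  let b := Module.finBasis ℝ V
  have e : (fun f : V →L[ℝ] V => f.det) = fun f : V →L[ℝ] V => ∑ σ : Equiv.Perm (Fin (Module.finrank ℝ V)),
      (Equiv.Perm.sign σ : ℝ) * ∏ i, LinearMap.toMatrix b b (↑f : V →ₗ[ℝ] V) (σ i) i := by
    ext f
    rw [ContinuousLinearMap.det, ← LinearMap.det_toMatrix b, Matrix.det_apply']
  rw [e]
  refine ContDiff.sum fun σ _ => contDiff_const.mul (contDiff_prod fun i _ => ?_)
  -- each entry is a continuous linear functional of `f`
  let ℓ : (V →L[ℝ] V) →ₗ[ℝ] ℝ :=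
    { toFun := fun f => LinearMap.toMatrix b b (f : V →ₗ[ℝ] V) (σ i) i
      map_add' := fun f g => by simp
      map_smul' := fun c f => by simp }
  exact (LinearMap.toContinuousLinearMap ℓ).contDiff

variable {A : Type*} [NormedCommRing A] [NormedAlgebra ℝ A] [CompleteSpace A]
  {N : Type*} [Fintype N] [DecidableEq N]

set_option backward.isDefEq.respectTransparency false in
open scoped Matrix.Norms.Operator in
/-- The matrix exponential is smooth (it is analytic, Mathlib `NormedSpace.exp_analytic`).
[folklore] -/
theorem contDiff_exp_matrix : ContDiff ℝ ∞ (NormedSpace.exp : Matrix N N A → Matrix N N A) :=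
  contDiff_iff_contDiffAt.2 fun x => (NormedSpace.exp_analytic (𝕂 := ℝ) x).contDiffAt

end Generic

/-! ### 1. The change of variables between exponential and linear coordinates -/

section Chart

variable {n : ℕ} {K : Type} [Field K] [NumberField K] {d : ℕ}

set_option backward.isDefEq.respectTransparency false in
set_option maxHeartbeats 800000 in
open scoped Matrix.Norms.Operator in
/-- **Exponential versus linear coordinates on `GL_n(K_∞)`.** Let
`Λ : ℝ^d ≃L M_n(K_∞)` be a continuous linear isomorphism. There is `ρ₀ > 0` such that for every
smooth `α₀ : ℝ^d → ℝ` with `tsupport α₀ ⊆ B(0, ρ₀)` there is a smooth compactly supported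
`β : ℝ^D → ℝ` (`ℝ^D` the coordinate space of `glCoord`), supported in `glUnitSet`, with
`∫ α₀(t) Ψ(glCoord (exp (Λ t))) dt = ∫ β(s) Ψ(s) ds` for every `Ψ : ℝ^D → ℂ`.
Proof: with a local logarithm `log` smooth near `1` (`exists_log_contDiffAt_nhds_one`), the map
`E'(t) = Λ⁻¹ exp(Λ t)` has the local inverse `L'(u) = Λ⁻¹ log(Λ u)`; change variables along `L'`
(`integral_image_eq_integral_abs_det_fderiv_smul`; the Jacobian `|det DL'|` is smooth by
`contDiff_clm_det`, non-vanishing since `DL' ∘ DE' = 1`), then along the linear isomorphism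
`glCoord ∘ Λ` (`exists_integral_comp_continuousLinearEquiv`). Knapp 2002, I.§10, VIII.§2.
[folklore] -/
theorem exists_coordWeight_of_expChart
    (Λ : (Fin d → ℝ) ≃L[ℝ] Matrix (Fin n) (Fin n) (mixedSpace K)) :
    ∃ ρ₀ : ℝ, 0 < ρ₀ ∧ ∀ α₀ : (Fin d → ℝ) → ℝ, ContDiff ℝ ∞ α₀ → tsupport α₀ ⊆ ball 0 ρ₀ →
      ∃ β : (GlIdx n K → ℝ) → ℝ, ContDiff ℝ ∞ β ∧ HasCompactSupport β ∧
        tsupport β ⊆ glUnitSet n K ∧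
        ∀ Ψ : (GlIdx n K → ℝ) → ℂ,
          ∫ t, (α₀ t : ℂ) * Ψ (glCoord n K (NormedSpace.exp (Λ t))) = ∫ s, (β s : ℂ) * Ψ s := by
  -- the local logarithm
  obtain ⟨log, hlog1, hlog2, hlog3⟩ :=
    exists_log_contDiffAt_nhds_one (A := mixedSpace K) (N := Fin n)
  -- the maps `E'` (chart) and `L'` (its local inverse) on `ℝ^d`
  set E' : (Fin d → ℝ) → (Fin d → ℝ) := fun t => Λ.symm (NormedSpace.exp (Λ t)) with hE'
  set L' : (Fin d → ℝ) → (Fin d → ℝ) := fun u => Λ.symm (log (Λ u)) with hL'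
  set u₁ : Fin d → ℝ := Λ.symm 1 with hu₁
  have hE'0 : E' 0 = u₁ := by simp [hE', hu₁]
  have hE's : ContDiff ℝ ∞ E' :=
    Λ.symm.contDiff.comp (contDiff_exp_matrix.comp Λ.contDiff)
  have hE'c : Continuous E' := hE's.continuous
  -- an open `V₁ ∋ u₁` on which `log ∘ Λ` is smooth and `exp ∘ log ∘ Λ = Λ`
  obtain ⟨O₁, hO₁, hO₁o, h1O₁⟩ : ∃ O₁ : Set (Matrix (Fin n) (Fin n) (mixedSpace K)),
      (∀ y ∈ O₁, ContDiffAt ℝ ∞ log y ∧ NormedSpace.exp (log y) = y) ∧ IsOpen O₁ ∧ (1 : Matrix _ _ _) ∈ O₁ :=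
    eventually_nhds_iff.1 (hlog1.and hlog2)
  set V₁ : Set (Fin d → ℝ) := (Λ : (Fin d → ℝ) → _) ⁻¹' O₁ with hV₁
  have hV₁o : IsOpen V₁ := hO₁o.preimage Λ.continuous
  have hu₁V : u₁ ∈ V₁ := by simp [hV₁, hu₁, h1O₁]
  have hlogs : ∀ u ∈ V₁, ContDiffAt ℝ ∞ log (Λ u) := fun u hu => (hO₁ _ hu).1
  have hexplog : ∀ u ∈ V₁, NormedSpace.exp (log (Λ u)) = Λ u := fun u hu => (hO₁ _ hu).2
  have hL's : ∀ u ∈ V₁, ContDiffAt ℝ ∞ L' u := fun u hu =>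
    Λ.symm.contDiff.contDiffAt.comp u ((hlogs u hu).comp u Λ.contDiff.contDiffAt)
  have hL'c : ContinuousOn L' V₁ := fun u hu => (hL's u hu).continuousAt.continuousWithinAt
  have hEL : ∀ u ∈ V₁, E' (L' u) = u := fun u hu => by
    simp only [hE', hL', ContinuousLinearEquiv.apply_symm_apply, hexplog u hu,
      ContinuousLinearEquiv.symm_apply_apply]
  -- an open ball `S = B(0, ρ₀)` on which `log ∘ exp ∘ Λ = Λ` and `E'` maps into `V₁`
  obtain ⟨O₀, hO₀, hO₀o, h0O₀⟩ : ∃ O₀ : Set (Matrix (Fin n) (Fin n) (mixedSpace K)),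
      (∀ x ∈ O₀, log (NormedSpace.exp x) = x) ∧ IsOpen O₀ ∧ (0 : Matrix _ _ _) ∈ O₀ :=
    eventually_nhds_iff.1 hlog3
  have hnhds : (Λ : (Fin d → ℝ) → _) ⁻¹' O₀ ∩ E' ⁻¹' V₁ ∈ 𝓝 (0 : Fin d → ℝ) := by
    refine Filter.inter_mem ((hO₀o.preimage Λ.continuous).mem_nhds (by simp [h0O₀]))
      ((hV₁o.preimage hE'c).mem_nhds ?_)
    rw [mem_preimage, hE'0]; exact hu₁V
  obtain ⟨ρ₀, hρ₀, hball⟩ := Metric.mem_nhds_iff.1 hnhds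
  set S : Set (Fin d → ℝ) := ball 0 ρ₀ with hS
  have hlogexp : ∀ t ∈ S, log (NormedSpace.exp (Λ t)) = Λ t := fun t ht => hO₀ _ (hball ht).1
  have hE'V : ∀ t ∈ S, E' t ∈ V₁ := fun t ht => (hball ht).2
  have hLE : ∀ t ∈ S, L' (E' t) = t := fun t ht => by
    simp only [hE', hL', ContinuousLinearEquiv.apply_symm_apply, hlogexp t ht,
      ContinuousLinearEquiv.symm_apply_apply]
  -- the image `s' = E' '' S = V₁ ∩ L'⁻¹ S`, an open set
  set s' : Set (Fin d → ℝ) := V₁ ∩ L' ⁻¹' S with hs'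
  have hs'eq : E' '' S = s' := by
    ext u; constructor
    · rintro ⟨t, ht, rfl⟩
      exact ⟨hE'V t ht, by rw [mem_preimage, hLE t ht]; exact ht⟩
    · rintro ⟨hu, hu'⟩
      exact ⟨L' u, hu', hEL u hu⟩
  have hs'o : IsOpen s' := hL'c.isOpen_inter_preimage hV₁o isOpen_ball
  have hLs' : L' '' s' = S := by
    ext t; constructor
    · rintro ⟨u, ⟨-, hu'⟩, rfl⟩; exact hu'
    · intro ht; exact ⟨E' t, hs'eq ▸ ⟨t, ht, rfl⟩, hLE t ht⟩
  -- derivatives: `DL' u` for `u ∈ V₁`, and `det (DL' u) ≠ 0` on `s'`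
  set DL : (Fin d → ℝ) → (Fin d → ℝ) →L[ℝ] (Fin d → ℝ) := fun u =>
    (Λ.symm : Matrix (Fin n) (Fin n) (mixedSpace K) →L[ℝ] (Fin d → ℝ)).comp
      ((fderiv ℝ log (Λ u)).comp (Λ : (Fin d → ℝ) →L[ℝ] Matrix (Fin n) (Fin n) (mixedSpace K)))
    with hDL
  have hDL' : ∀ u ∈ V₁, HasFDerivAt L' (DL u) u := by
    intro u hu
    have h1 : HasFDerivAt log (fderiv ℝ log (Λ u)) (Λ u) :=
      ((hlogs u hu).differentiableAt (by simp)).hasFDerivAt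
    exact Λ.symm.hasFDerivAt.comp u (h1.comp u Λ.hasFDerivAt)
  have hdetDL : ∀ u ∈ s', (DL u).det ≠ 0 := by
    intro u hu
    -- `L' ∘ E' = id` near `t = L' u ∈ S`, so `DL u ∘ DE' t = 1`
    set t := L' u with ht
    have htS : t ∈ S := hu.2
    have hEt : E' t = u := hEL u hu.1
    have hE't : HasFDerivAt E' (fderiv ℝ E' t) t := (hE's.differentiable (by simp) t).hasFDerivAt
    have hcomp : HasFDerivAt (L' ∘ E') ((DL u).comp (fderiv ℝ E' t)) t := by
      have h : HasFDerivAt L' (DL u) (E' t) := by rw [hEt]; exact hDL' u hu.1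
      exact h.comp t hE't
    have hid : HasFDerivAt (L' ∘ E') (ContinuousLinearMap.id ℝ _) t := by
      refine (hasFDerivAt_id t).congr_of_eventuallyEq ?_
      filter_upwards [isOpen_ball.mem_nhds htS] with t' ht'
      exact hLE t' ht'
    have heq := hcomp.unique hid
    have hdet : (DL u).det * (fderiv ℝ E' t).det = 1 := by
      have h := congrArg ContinuousLinearMap.det heq
      simpa [ContinuousLinearMap.det, LinearMap.det_comp] using h
    intro h0
    rw [h0, zero_mul] at hdet
    exact zero_ne_one hdet
  -- the Jacobian `J u = |det (DL u)|` is smooth on `s'`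
  have hDLs : ∀ u ∈ V₁, ContDiffAt ℝ ∞ DL u := by
    intro u hu
    have h1 : ContDiffAt ℝ ∞ (fun u => fderiv ℝ log (Λ u)) u :=
      ((hlogs u hu).fderiv_right (m := ∞) (by simp)).comp u Λ.contDiff.contDiffAt
    have h2 : ContDiffAt ℝ ∞ (fun u => (fderiv ℝ log (Λ u)).comp
        (Λ : (Fin d → ℝ) →L[ℝ] Matrix (Fin n) (Fin n) (mixedSpace K))) u :=
      h1.clm_comp contDiffAt_const
    have h3 : ContDiffAt ℝ ∞ (fun u => (Λ.symm : Matrix (Fin n) (Fin n) (mixedSpace K) →L[ℝ] (Fin d → ℝ)).comp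
        ((fderiv ℝ log (Λ u)).comp (Λ : (Fin d → ℝ) →L[ℝ] Matrix (Fin n) (Fin n) (mixedSpace K)))) u :=
      contDiffAt_const.clm_comp h2
    simpa only [hDL] using h3
  have hJs : ∀ u ∈ s', ContDiffAt ℝ ∞ (fun u => |(DL u).det|) u := by
    intro u hu
    have h1 : ContDiffAt ℝ ∞ (fun u => (DL u).det) u :=
      contDiff_clm_det.contDiffAt.comp u (hDLs u hu.1)
    exact (contDiffAt_abs (hdetDL u hu)).comp u h1
  refine ⟨ρ₀, hρ₀, fun α₀ hα₀ hα₀S => ?_⟩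
  -- the weight in `ℝ^d`: `βd = 1_{s'} · |det DL| · (α₀ ∘ L')`
  set βd : (Fin d → ℝ) → ℝ := s'.indicator fun u => |(DL u).det| * α₀ (L' u) with hβd
  have hα₀c : HasCompactSupport α₀ :=
    IsCompact.of_isClosed_subset (isCompact_closedBall 0 ρ₀) (isClosed_tsupport α₀)
      (hα₀S.trans ball_subset_closedBall)
  have hKc : IsCompact (E' '' tsupport α₀) := hα₀c.image hE'c
  have hKs' : E' '' tsupport α₀ ⊆ s' := (image_mono hα₀S).trans hs'eq.le
  have hsupp_βd : Function.support βd ⊆ E' '' tsupport α₀ := by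
    intro u hu
    rw [Function.mem_support] at hu
    have hus' : u ∈ s' := by
      by_contra h; exact hu (by rw [hβd, indicator_of_notMem h])
    have hα : α₀ (L' u) ≠ 0 := by
      intro h; apply hu; rw [hβd, indicator_of_mem hus', h, mul_zero]
    exact ⟨L' u, subset_tsupport _ hα, hEL u hus'.1⟩
  have htsupp_βd : tsupport βd ⊆ E' '' tsupport α₀ :=
    closure_minimal hsupp_βd hKc.isClosed
  have hβdc : HasCompactSupport βd := IsCompact.of_isClosed_subset hKc (isClosed_tsupport _) htsupp_βd
  have hβds : ContDiff ℝ ∞ βd := by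
    refine contDiff_iff_contDiffAt.2 fun u => ?_
    by_cases hu : u ∈ s'
    · have hev : βd =ᶠ[𝓝 u] fun u => |(DL u).det| * α₀ (L' u) := by
        filter_upwards [hs'o.mem_nhds hu] with v hv
        rw [hβd, indicator_of_mem hv]
      refine ContDiffAt.congr_of_eventuallyEq ?_ hev
      exact (hJs u hu).mul (hα₀.contDiffAt.comp u (hL's u hu.1))
    · have hu' : u ∉ tsupport βd := fun h => hu (hKs' (htsupp_βd h))
      exact (contDiffAt_const (c := (0 : ℝ))).congr_of_eventuallyEq
        (notMem_tsupport_iff_eventuallyEq.1 hu')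
  -- the linear change of variables `eD = glCoord ∘ Λ`
  set eD : (Fin d → ℝ) ≃L[ℝ] (GlIdx n K → ℝ) := Λ.trans (glCoord n K) with heD
  obtain ⟨c₁, hc₁, hcov⟩ := exists_integral_comp_continuousLinearEquiv
    (volume : Measure (Fin d → ℝ)) (volume : Measure (GlIdx n K → ℝ)) eD
  -- the weight on the coordinate space
  set β : (GlIdx n K → ℝ) → ℝ := fun s => c₁ * βd (eD.symm s) with hβ
  have hβs : ContDiff ℝ ∞ β := contDiff_const.mul (hβds.comp eD.symm.contDiff)
  have hβc : HasCompactSupport β := (hβdc.comp_homeomorph eD.symm.toHomeomorph).mul_left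
  have hβU : tsupport β ⊆ glUnitSet n K := by
    refine (tsupport_mul_subset_right (f := fun _ => c₁) (g := fun s => βd (eD.symm s))).trans ?_
    intro s hs
    have h1 : eD.symm s ∈ tsupport βd := by
      have hsub : tsupport (fun s => βd (eD.symm s)) ⊆ (eD.symm : _ → _) ⁻¹' tsupport βd :=
        closure_minimal (fun x hx => subset_closure hx)
          ((isClosed_tsupport βd).preimage eD.symm.continuous)
      exact hsub hs
    have h2 : eD.symm s ∈ E' '' S := by rw [hs'eq]; exact hKs' (htsupp_βd h1)
    obtain ⟨t, -, ht⟩ := h2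
    have hs' : s = glCoord n K (NormedSpace.exp (Λ t)) := by
      have h3 : eD (E' t) = s := by rw [ht]; exact eD.apply_symm_apply s
      rw [← h3, heD]
      simp [hE']
    rw [hs']
    exact glCoord_coe_mem_glUnitSet (expGL (Λ t))
  refine ⟨β, hβs, hβc, hβU, fun Ψ => ?_⟩
  -- Step 1: change of variables along `L'` on `s'`
  have hcv := integral_image_eq_integral_abs_det_fderiv_smul (volume : Measure (Fin d → ℝ)) hs'o.measurableSet
    (f := L') (f' := DL) (fun u hu => (hDL' u hu.1).hasFDerivWithinAt)
    (fun u hu v hv huv => by rw [← hEL u hu.1, ← hEL v hv.1, huv])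
    (fun t => (α₀ t : ℂ) * Ψ (glCoord n K (NormedSpace.exp (Λ t))))
  rw [hLs'] at hcv
  have hlhs : ∫ t in S, (α₀ t : ℂ) * Ψ (glCoord n K (NormedSpace.exp (Λ t))) =
      ∫ t, (α₀ t : ℂ) * Ψ (glCoord n K (NormedSpace.exp (Λ t))) := by
    refine setIntegral_eq_integral_of_forall_compl_eq_zero fun t ht => ?_
    have : α₀ t = 0 := image_eq_zero_of_notMem_tsupport fun h => ht (hα₀S h)
    rw [this, Complex.ofReal_zero, zero_mul]
  -- Step 2: rewrite the right-hand side as `∫ βd u · Ψ (eD u)`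
  have hrhs : ∫ u in s', |(DL u).det| • ((α₀ (L' u) : ℂ) * Ψ (glCoord n K (NormedSpace.exp (Λ (L' u))))) =
      ∫ u, (βd u : ℂ) * Ψ (eD u) := by
    rw [← integral_indicator hs'o.measurableSet]
    refine integral_congr_ae (Eventually.of_forall fun u => ?_)
    show s'.indicator (fun u => |(DL u).det| • ((α₀ (L' u) : ℂ) *
      Ψ (glCoord n K (NormedSpace.exp (Λ (L' u)))))) u = (βd u : ℂ) * Ψ (eD u)
    by_cases hu : u ∈ s'
    · rw [indicator_of_mem hu, hβd, indicator_of_mem hu]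
      have he : glCoord n K (NormedSpace.exp (Λ (L' u))) = eD u := by
        have h := hEL u hu.1
        simp only [hE'] at h
        have h2 := congrArg (fun v => glCoord n K (Λ v)) h
        simp only [ContinuousLinearEquiv.apply_symm_apply] at h2
        rw [h2, heD]; rfl
      rw [he, Complex.real_smul]
      push_cast; ring
    · rw [indicator_of_notMem hu, hβd, indicator_of_notMem hu]; simp
  -- Step 3: the linear change of variables
  have hlin := hcov (fun s => (βd (eD.symm s) : ℂ) * Ψ s)
  simp only [ContinuousLinearEquiv.symm_apply_apply] at hlin
  rw [← hlhs, hcv, hrhs, hlin, ← integral_const_mul]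
  refine integral_congr_ae (Eventually.of_forall fun s => ?_)
  simp only [hβ]; push_cast; ring

end Chart

end Literature.NumberTheory.Automorphic
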